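import Literature.Analysis.Asymptotics.ComplexLinearRecurrenceDominantRoot
import Mathlib.RingTheory.PowerSeries.Basic
import HarnessLib

/-!
# Coefficient recurrences of the two-wall strip denominators over any commutative ring, and the cubic `(t − s)(t² + pt + κ)` algebra

Model-light algebra for the complex-fugacity programme (lane «pcv-sawmu», DOOR-ap5-g27 item 1).  The rational two-wall strip series has
denominator `q(X²)·(1 − wvX⁴)²`, `q(u) = (1 − wu)(1 − vu) − wvu³`; the tree derives from it, for REAL fugacities and privately
(`…WidthOneParityAmplitude`, `…WidthOneUniformAmplitude`), the order-6 and order-8 coefficient recurrences and the cubic recurrence of the parity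
subsequences with characteristic polynomial `(t − s)(t² + (s − w − v)t + wv/s)`, `s` a root of `s(s − w)(s − v) = wv`.  THIS FILE states that algebra
once over an arbitrary commutative ring / field, in the exact shape consumed by
`Literature.Analysis.Asymptotics.exists_tendsto_norm_sub_le_of_rec_three_complex`:

* §1 `coeff_rec_six_of_mul_sextic` (`φ·[(1 − wX²)(1 − vX²) − wvX⁶] = U` ⇒ `[X^{N+6}]φ = (w+v)[X^{N+4}]φ − wv[X^{N+2}]φ + wv[X^N]φ + [X^{N+6}]U`),
  `coeff_rec_eight_of_mul_sq` (`φ·(1 − wvX⁴)² = V` ⇒ `[X^{N+8}]φ = 2wv[X^{N+4}]φ − w²v²[X^N]φ + [X^{N+8}]V`).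
* §2 `parity_rec_three` — a sequence with `e_{N+6} = (w+v)e_{N+4} − wv e_{N+2} + wv e_N` has parity subsequences `b_M = e_{2M+c}` with
  `b_{M+3} = (w+v)b_{M+2} + (−wv)b_{M+1} + wv·b_M`.
* §3 `cubic_charpoly_data` — if `s(s − w)(s − v) = wv` and `s ≠ 0` (in a field) then with `p = s − w − v`, `κ = wv/s`:
  `w + v = s − p`, `−wv = p s − κ`, `wv = κ s` — i.e. `t³ − (w+v)t² + wv t − wv = (t − s)(t² + pt + κ)`, the hypotheses `hA, hB, hC` of the
  dominant-root theorem; ★ `exists_tendsto_parity_of_rec_six` assembles §2–§3 with the complex dominant-root theorem: the parity subsequences of any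
  complex solution of the order-6 recurrence have explicit two-term asymptotics `‖e_{2M+c} − L s^M‖ ≤ Γ(M+1)R^M‖s‖/(‖s‖ − R)²` as soon as the cofactor
  roots have modulus `≤ R < ‖s‖`.

## Sources
R. P. Stanley, *Enumerative Combinatorics* 1 (2nd ed.) §4.1 Theorem 4.1.1 ((i) ⟺ (ii): rational series ⟺ linear recurrences; (iii) exponential polynomials);
N. R. Beaton et al., CMP 326 (2014), arXiv:1109.0358v5 §3.2 (p. 12).  Lane statements; nothing is quoted AS PRINTED.
-/

noncomputable section

open Filter Finset PowerSeries
open scoped Topology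

namespace Literature.Analysis.Asymptotics

/-! ## §1 Coefficient recurrences from the two denominators -/

/-- If `φ · [(1 − wX²)(1 − vX²) − wvX⁶] = U` in `R⟦X⟧` then `[X^{N+6}]φ = (w+v)[X^{N+4}]φ − wv[X^{N+2}]φ + wv[X^N]φ + [X^{N+6}]U`.
[cite: Stanley2012EC1, §4.1 Theorem 4.1.1 ((i) ⟺ (ii))] -/
theorem coeff_rec_six_of_mul_sextic {R : Type*} [CommRing R] {w v : R} {φ U : R⟦X⟧}
    (h : φ * ((1 - C w * X ^ 2) * (1 - C v * X ^ 2) - C w * C v * X ^ 6) = U) (N : ℕ) :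
    coeff (N + 6) φ = (w + v) * coeff (N + 4) φ - w * v * coeff (N + 2) φ + w * v * coeff N φ + coeff (N + 6) U := by
  have h' : φ = U + C (w + v) * (φ * X ^ 2) - C (w * v) * (φ * X ^ 4) + C (w * v) * (φ * X ^ 6) := by
    simp only [map_add, map_mul]
    linear_combination h
  have e2 : coeff (N + 6) (φ * X ^ 2) = coeff (N + 4) φ := by
    rw [show N + 6 = N + 4 + 2 by ring, PowerSeries.coeff_mul_X_pow]
  have e4 : coeff (N + 6) (φ * X ^ 4) = coeff (N + 2) φ := by
    rw [show N + 6 = N + 2 + 4 by ring, PowerSeries.coeff_mul_X_pow]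
  have e6 : coeff (N + 6) (φ * X ^ 6) = coeff N φ := PowerSeries.coeff_mul_X_pow φ 6 N
  have := congrArg (coeff (N + 6)) h'
  rw [map_add, map_sub, map_add, PowerSeries.coeff_C_mul, PowerSeries.coeff_C_mul, PowerSeries.coeff_C_mul, e2, e4, e6]
    at this
  linear_combination this

/-- If `φ · (1 − wvX⁴)² = V` in `R⟦X⟧` then `[X^{N+8}]φ = 2wv[X^{N+4}]φ − w²v²[X^N]φ + [X^{N+8}]V`.
[cite: Stanley2012EC1, §4.1 Theorem 4.1.1 ((i) ⟺ (ii))] -/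
theorem coeff_rec_eight_of_mul_sq {R : Type*} [CommRing R] {w v : R} {φ V : R⟦X⟧}
    (h : φ * (1 - C w * C v * X ^ 4) ^ 2 = V) (N : ℕ) :
    coeff (N + 8) φ = 2 * (w * v) * coeff (N + 4) φ - (w * v) ^ 2 * coeff N φ + coeff (N + 8) V := by
  have h' : φ = V + C (2 * (w * v)) * (φ * X ^ 4) - C ((w * v) ^ 2) * (φ * X ^ 8) := by
    simp only [map_mul, map_pow, map_ofNat]
    linear_combination h
  have e4 : coeff (N + 8) (φ * X ^ 4) = coeff (N + 4) φ := by
    rw [show N + 8 = N + 4 + 4 by ring, PowerSeries.coeff_mul_X_pow]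
  have e8 : coeff (N + 8) (φ * X ^ 8) = coeff N φ := PowerSeries.coeff_mul_X_pow φ 8 N
  have := congrArg (coeff (N + 8)) h'
  rw [map_sub, map_add, PowerSeries.coeff_C_mul, PowerSeries.coeff_C_mul, e4, e8] at this
  linear_combination this

/-! ## §2 Parity subsequences -/

/-- A sequence obeying the order-6 recurrence `e_{N+6} = (w+v)e_{N+4} − wv e_{N+2} + wv e_N` has, for each residue `c`, the parity subsequence
`b_M = e_{2M+c}` obeying the CUBIC recurrence `b_{M+3} = (w+v)b_{M+2} + (−wv)b_{M+1} + wv·b_M`. [cite: Stanley2012EC1, §4.1 Theorem 4.1.1 (lane plumbing)] -/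
theorem parity_rec_three {R : Type*} [CommRing R] {w v : R} {e : ℕ → R}
    (he : ∀ N, e (N + 6) = (w + v) * e (N + 4) - w * v * e (N + 2) + w * v * e N) (c : ℕ) (M : ℕ) :
    e (2 * (M + 3) + c) = (w + v) * e (2 * (M + 2) + c) + -(w * v) * e (2 * (M + 1) + c) + w * v * e (2 * M + c) := by
  rw [show 2 * (M + 3) + c = 2 * M + c + 6 by ring, show 2 * (M + 2) + c = 2 * M + c + 4 by ring,
    show 2 * (M + 1) + c = 2 * M + c + 2 by ring, he]
  ring

/-! ## §3 The cubic `t³ − (w+v)t² + wv·t − wv = (t − s)(t² + pt + κ)` and the two-term asymptotics of the parity subsequences -/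

/-- **Characteristic-polynomial data.**  In a field, if `s(s − w)(s − v) = wv` and `s ≠ 0`, then with `p := s − w − v`, `κ := wv/s`:
`w + v = s − p`, `−wv = p·s − κ`, `wv = κ·s` — the factorisation `t³ − (w+v)t² + wv·t − wv = (t − s)(t² + pt + κ)` written as the three
coefficient identities `hA, hB, hC` of `exists_tendsto_norm_sub_le_of_rec_three_complex`. [cite: Stanley2012EC1, §4.1 Theorem 4.1.1 (iii) (lane plumbing)] -/
theorem cubic_charpoly_data {K : Type*} [Field K] {w v s : K} (hs : s ≠ 0) (hcubic : s * (s - w) * (s - v) = w * v) :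
    w + v = s - (s - w - v) ∧ -(w * v) = (s - w - v) * s - w * v / s ∧ w * v = w * v / s * s := by
  refine ⟨by ring, ?_, by field_simp⟩
  have e : ((s - w - v) * s - w * v / s) * s = -(w * v) * s := by
    field_simp
    linear_combination s * hcubic - s * hcubic + hcubic
  exact (mul_right_cancel₀ hs e).symm

/-- ★ **TWO-TERM ASYMPTOTICS OF THE PARITY SUBSEQUENCES OF A COMPLEX SOLUTION OF THE ORDER-6 RECURRENCE.**  Let `e : ℕ → ℂ` satisfy
`e_{N+6} = (w+v)e_{N+4} − wv e_{N+2} + wv e_N` (`w, v ∈ ℂ`), let `s ∈ ℂ`, `s ≠ 0`, solve `s(s − w)(s − v) = wv`, and suppose every root of the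
cofactor `σ² + (s − w − v)σ + wv/s` has modulus `≤ R` with `0 < R < ‖s‖`.  Then for each residue `c` the parity subsequence `b_M = e_{2M+c}` satisfies:
`b_M/s^M → L` for some `L ∈ ℂ` and `‖b_M − L s^M‖ ≤ (‖b₁ − s b₀‖ + ‖b₂ − s b₁‖/R)(M+1)R^M‖s‖/(‖s‖ − R)²` for every `M`
(`exists_tendsto_norm_sub_le_of_rec_three_complex` with the data of `cubic_charpoly_data`). [cite: Stanley2012EC1, §4.1 Theorem 4.1.1 (iii) (lane statement, complex data)] -/
theorem exists_tendsto_parity_of_rec_six {w v s : ℂ} {R : ℝ} {e : ℕ → ℂ}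
    (he : ∀ N, e (N + 6) = (w + v) * e (N + 4) - w * v * e (N + 2) + w * v * e N)
    (hs : s ≠ 0) (hcubic : s * (s - w) * (s - v) = w * v) (hR0 : 0 < R) (hRs : R < ‖s‖)
    (hroot : ∀ σ : ℂ, σ ^ 2 + (s - w - v) * σ + w * v / s = 0 → ‖σ‖ ≤ R) (c : ℕ) :
    ∃ L : ℂ, Tendsto (fun M => e (2 * M + c) / s ^ M) atTop (𝓝 L) ∧
      ∀ M : ℕ, ‖e (2 * M + c) - L * s ^ M‖ ≤
        (‖e (2 * 1 + c) - s * e (2 * 0 + c)‖ + ‖e (2 * 2 + c) - s * e (2 * 1 + c)‖ / R) * ((M : ℝ) + 1) * R ^ M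
          * (‖s‖ / (‖s‖ - R) ^ 2) := by
  obtain ⟨hA, hB, hC⟩ := cubic_charpoly_data hs hcubic
  exact exists_tendsto_norm_sub_le_of_rec_three_complex hR0 hRs hA hB hC hroot (fun M => e (2 * M + c))
    (fun M => parity_rec_three he c M)

end Literature.Analysis.Asymptotics

end
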